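import Literature.LinearAlgebra.Matrix.GeneralLinearGroupSquaresPi
import HarnessLib

/-!
# `GL_n` over a product of rings modulo squares: componentwise representatives

Layer `Literature/LinearAlgebra/Matrix`, namespace `Literature.LinearAlgebra.Matrix.GeneralLinearGroup` (sequel of
`GeneralLinearGroupSquaresPi`).  THEOREMS ONLY.

For a product ring `R = (∏_{k ∈ κ₁} A_k) × (∏_{k ∈ κ₂} B_k)` (the shape of `K ⊗_ℚ ℝ = ℝ^{r₁} × ℂ^{r₂}` for a number field `K`,
`mixedSpace K`) suppose every `GL_ι(B_k)` is generated by squares (e.g. `B_k = ℂ`) and every `GL_ι(A_k)` is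
`⟨squares⟩ ∪ ⟨squares⟩ · ε_k` for a given `ε_k` (e.g. `A_k = ℝ`, `ε_k` of negative determinant:
`GeneralLinearGroupSquaresReal.exists_mem_closure_isSquare_mul_eq`).  Then (**`exists_mem_closure_isSquare_mul_eq_of_components`**)
every `g ∈ GL_ι(R)` is `u · r` with `u` a product of squares and `r` a SIGN-PATTERN element: its component at each `A_k` is
`1` or `ε_k`, its component at each `B_k` is `1` (components through `Matrix.GeneralLinearGroup.map` of the evaluation ring
homomorphisms `(Pi.evalRingHom _ k).comp (RingHom.fst _ _)` / `… (RingHom.snd _ _)`).  The matrix-ring isomorphism `M_ι(R) ≅ (∏ M_ι(A_k)) × (∏ M_ι(B_k))` is built inside the proof, as in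
`GeneralLinearGroupSquaresPi`.  (Specialisation `A_k = ℝ`, `B_k = ℂ`: the sequel `GeneralLinearGroupSquaresRealComplexReps`.)
Dually (**`monoidHom_eq_one_of_components`**): a square-killing homomorphism `GL_ι(R) →* M`
into a commutative monoid that kills the `#κ₁` one-coordinate elements `ε̂_k` (`ε_k` at `A_k`, `1` elsewhere) is trivial
(Mathlib `MonoidHom.pi_ext`: a homomorphism out of a finite product is determined on the one-coordinate elements).
[cite: Artin1988, Chap. IV Thm. 4.6–4.7] (transport corollaries of the generation of `GL_n` by transvections and diagonal matrices).

Use: the representative set `Rset` of `NumberTheory/Automorphic/UnitaryGroupDoubledSiegelSquaresReps` over `R = E ⊗ ℝ` for a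
number field `E` with real places (archimedean places of type (ii) of [GelbartRogawski1991, Prop. 3.1.1]).  Nothing in this file
depends on that application.

## References

* [Artin1988] E. Artin, *Geometric Algebra*, Chap. IV, Thm. 4.6, Thm. 4.7.
-/

set_option autoImplicit false

open Matrix

namespace Literature.LinearAlgebra.Matrix.GeneralLinearGroup

variable {ι : Type*} [Fintype ι] [DecidableEq ι]

/-- the image of a product of squares under a homomorphism is a product of squares. [folklore] -/
private theorem map_mem_closure_isSquare {G G' : Type*} [Group G] [Group G'] (f : G →* G') {x : G}
    (hx : x ∈ Subgroup.closure {g : G | IsSquare g}) : f x ∈ Subgroup.closure {g : G' | IsSquare g} := by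
  induction hx using Subgroup.closure_induction with
  | mem y hy =>
    obtain ⟨r, rfl⟩ := hy
    rw [map_mul]
    exact Subgroup.subset_closure ⟨f r, rfl⟩
  | one => rw [map_one]; exact Subgroup.one_mem _
  | mul y z _ _ hy hz => rw [map_mul]; exact Subgroup.mul_mem _ hy hz
  | inv y _ hy => rw [map_inv]; exact Subgroup.inv_mem _ hy

section Components

variable {κ₁ κ₂ : Type*} [Fintype κ₁] [DecidableEq κ₁] [Fintype κ₂] [DecidableEq κ₂]
  (A : κ₁ → Type*) (B : κ₂ → Type*) [∀ k, CommRing (A k)] [∀ k, CommRing (B k)]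

/-- **componentwise representatives modulo squares in `GL_ι((∏ A_k) × (∏ B_k))`.**  If every `GL_ι(B_k)` is generated by squares and
every element of `GL_ι(A_k)` is `u` or `u · ε_k` with `u` a product of squares, then every `g ∈ GL_ι((∏ A_k) × (∏ B_k))` is
`u · r` with `u` a product of squares and `r` a sign-pattern element: `r_{A_k} ∈ {1, ε_k}`, `r_{B_k} = 1`.
[cite: Artin1988, Chap. IV Thm. 4.7] -/
theorem exists_mem_closure_isSquare_mul_eq_of_components (ε : ∀ k, GL ι (A k))
    (hA : ∀ (k) (g : GL ι (A k)), ∃ u ∈ Subgroup.closure {g : GL ι (A k) | IsSquare g}, g = u ∨ g = u * ε k)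
    (hB : ∀ k, Subgroup.closure {g : GL ι (B k) | IsSquare g} = ⊤)
    (g : GL ι ((∀ k, A k) × (∀ k, B k))) :
    ∃ u ∈ Subgroup.closure {g : GL ι ((∀ k, A k) × (∀ k, B k)) | IsSquare g},
      ∃ r : GL ι ((∀ k, A k) × (∀ k, B k)), g = u * r ∧
        (∀ k, Matrix.GeneralLinearGroup.map (((Pi.evalRingHom A k).comp (RingHom.fst (∀ k, A k) (∀ k, B k)))) r = 1 ∨ Matrix.GeneralLinearGroup.map (((Pi.evalRingHom A k).comp (RingHom.fst (∀ k, A k) (∀ k, B k)))) r = ε k) ∧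
        (∀ k, Matrix.GeneralLinearGroup.map (((Pi.evalRingHom B k).comp (RingHom.snd (∀ k, A k) (∀ k, B k)))) r = 1) := by
  classical
  -- the matrix ring over the product is the product of the matrix rings
  let φ : Matrix ι ι ((∀ k, A k) × (∀ k, B k)) ≃+* (∀ k, Matrix ι ι (A k)) × (∀ k, Matrix ι ι (B k)) :=
    { toFun := fun M => (fun k => M.map (((Pi.evalRingHom A k).comp (RingHom.fst (∀ k, A k) (∀ k, B k)))), fun k => M.map (((Pi.evalRingHom B k).comp (RingHom.snd (∀ k, A k) (∀ k, B k)))))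
      invFun := fun P => Matrix.of fun i j => (fun k => P.1 k i j, fun k => P.2 k i j)
      left_inv := fun M => by ext i j <;> rfl
      right_inv := fun P => by ext k i j <;> rfl
      map_mul' := fun M N => by
        refine Prod.ext (funext fun k => ?_) (funext fun k => ?_)
        · change (M * N).map (((Pi.evalRingHom A k).comp (RingHom.fst (∀ k, A k) (∀ k, B k)))) = M.map (((Pi.evalRingHom A k).comp (RingHom.fst (∀ k, A k) (∀ k, B k)))) * N.map (((Pi.evalRingHom A k).comp (RingHom.fst (∀ k, A k) (∀ k, B k))))
          rw [Matrix.map_mul]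
        · change (M * N).map (((Pi.evalRingHom B k).comp (RingHom.snd (∀ k, A k) (∀ k, B k)))) = M.map (((Pi.evalRingHom B k).comp (RingHom.snd (∀ k, A k) (∀ k, B k)))) * N.map (((Pi.evalRingHom B k).comp (RingHom.snd (∀ k, A k) (∀ k, B k))))
          rw [Matrix.map_mul]
      map_add' := fun M N => by
        refine Prod.ext (funext fun k => ?_) (funext fun k => ?_) <;> rfl }
  let Φ : GL ι ((∀ k, A k) × (∀ k, B k)) ≃* (∀ k, GL ι (A k)) × (∀ k, GL ι (B k)) :=
    (Units.mapEquiv φ.toMulEquiv).trans (MulEquiv.prodUnits.trans (MulEquiv.prodCongr MulEquiv.piUnits MulEquiv.piUnits))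
  -- components through `Φ` are the `GeneralLinearGroup.map`s of the evaluations
  have hΦ1 : ∀ (x : GL ι ((∀ k, A k) × (∀ k, B k))) k, (Φ x).1 k = Matrix.GeneralLinearGroup.map (((Pi.evalRingHom A k).comp (RingHom.fst (∀ k, A k) (∀ k, B k)))) x :=
    fun x k => Units.ext rfl
  have hΦ2 : ∀ (x : GL ι ((∀ k, A k) × (∀ k, B k))) k, (Φ x).2 k = Matrix.GeneralLinearGroup.map (((Pi.evalRingHom B k).comp (RingHom.snd (∀ k, A k) (∀ k, B k)))) x :=
    fun x k => Units.ext rfl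
  -- choose componentwise
  have hA' := fun k => hA k ((Φ g).1 k)
  choose uA huA hgA using hA'
  have hB' : ∀ k, (Φ g).2 k ∈ Subgroup.closure {g : GL ι (B k) | IsSquare g} := fun k => (hB k) ▸ Subgroup.mem_top _
  -- the representative pattern
  let rA : ∀ k, GL ι (A k) := fun k => if (Φ g).1 k = uA k then 1 else ε k
  have hrA : ∀ k, (Φ g).1 k = uA k * rA k := by
    intro k
    by_cases h : (Φ g).1 k = uA k
    · simp only [rA, h, if_true, mul_one]
    · simp only [rA, h, if_false]
      exact (hgA k).resolve_left h
  set U : (∀ k, GL ι (A k)) × (∀ k, GL ι (B k)) := (uA, (Φ g).2) with hU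
  set Rr : (∀ k, GL ι (A k)) × (∀ k, GL ι (B k)) := (rA, 1) with hRr
  have hgUR : Φ g = U * Rr := by
    refine Prod.ext (funext fun k => ?_) (funext fun k => ?_)
    · rw [hU, hRr, Prod.fst_mul, Pi.mul_apply]
      exact hrA k
    · simp only [hU, hRr, Prod.snd_mul, Pi.mul_apply, Pi.one_apply, mul_one]
  -- `U` is a product of squares in the product group
  have hUmem : U ∈ Subgroup.closure {g : (∀ k, GL ι (A k)) × (∀ k, GL ι (B k)) | IsSquare g} := by
    have h1 : ((uA, 1) : (∀ k, GL ι (A k)) × (∀ k, GL ι (B k))) ∈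
        Subgroup.closure {g : (∀ k, GL ι (A k)) × (∀ k, GL ι (B k)) | IsSquare g} := by
      have hpi : uA ∈ Subgroup.closure {g : ∀ k, GL ι (A k) | IsSquare g} := by
        refine Subgroup.pi_mem_of_mulSingle_mem uA fun k => ?_
        exact map_mem_closure_isSquare (MonoidHom.mulSingle (fun k => GL ι (A k)) k) (huA k)
      exact map_mem_closure_isSquare (MonoidHom.inl (∀ k, GL ι (A k)) (∀ k, GL ι (B k))) hpi
    have h2 : ((1, (Φ g).2) : (∀ k, GL ι (A k)) × (∀ k, GL ι (B k))) ∈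
        Subgroup.closure {g : (∀ k, GL ι (A k)) × (∀ k, GL ι (B k)) | IsSquare g} := by
      have hpi : (Φ g).2 ∈ Subgroup.closure {g : ∀ k, GL ι (B k) | IsSquare g} := by
        refine Subgroup.pi_mem_of_mulSingle_mem _ fun k => ?_
        exact map_mem_closure_isSquare (MonoidHom.mulSingle (fun k => GL ι (B k)) k) (hB' k)
      exact map_mem_closure_isSquare (MonoidHom.inr (∀ k, GL ι (A k)) (∀ k, GL ι (B k))) hpi
    have h12 := Subgroup.mul_mem _ h1 h2
    rw [Prod.mk_mul_mk, mul_one, one_mul] at h12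
    exact h12
  -- pull back along `Φ`
  refine ⟨Φ.symm U, ?_, Φ.symm Rr, ?_, fun k => ?_, fun k => ?_⟩
  · exact map_mem_closure_isSquare Φ.symm.toMonoidHom hUmem
  · apply Φ.injective
    rw [map_mul, Φ.apply_symm_apply, Φ.apply_symm_apply]
    exact hgUR
  · rw [← hΦ1, Φ.apply_symm_apply, hRr]
    change (if (Φ g).1 k = uA k then 1 else ε k) = 1 ∨ (if (Φ g).1 k = uA k then 1 else ε k) = ε k
    split_ifs
    · exact Or.inl rfl
    · exact Or.inr rfl
  · rw [← hΦ2, Φ.apply_symm_apply, hRr]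
    rfl

/-- **a square-killing homomorphism `f : GL_ι((∏ A_k) × (∏ B_k)) →* M` (`M` commutative) is trivial as soon as it kills the
one-coordinate elements `ε̂_k`** (`ε_k` at the coordinate `A_k`, `1` at every other coordinate), when every `GL_ι(B_k)` is
generated by squares and every `GL_ι(A_k)` is `⟨squares⟩ · {1, ε_k}`: `f` factors through the product decomposition
`GL_ι((∏ A_k) × (∏ B_k)) ≅ ∏ GL_ι(A_k) × ∏ GL_ι(B_k)` and a homomorphism out of a finite product into a commutative monoid is
determined on the one-coordinate elements (Mathlib `MonoidHom.pi_ext`).  So a sign-type character is pinned down by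
`#κ₁` values, not `2^{#κ₁}`. [cite: Artin1988, Chap. IV Thm. 4.7] -/
theorem monoidHom_eq_one_of_components {M : Type*} [CommMonoid M] (ε : ∀ k, GL ι (A k))
    (hA : ∀ (k) (g : GL ι (A k)), ∃ u ∈ Subgroup.closure {g : GL ι (A k) | IsSquare g}, g = u ∨ g = u * ε k)
    (hB : ∀ k, Subgroup.closure {g : GL ι (B k) | IsSquare g} = ⊤)
    (f : GL ι ((∀ k, A k) × (∀ k, B k)) →* M) (hsq : ∀ g, f (g * g) = 1)
    (hε : ∀ (k) (g : GL ι ((∀ k, A k) × (∀ k, B k))),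
      Matrix.GeneralLinearGroup.map (((Pi.evalRingHom A k).comp (RingHom.fst (∀ k, A k) (∀ k, B k)))) g = ε k →
      (∀ k', k' ≠ k → Matrix.GeneralLinearGroup.map (((Pi.evalRingHom A k').comp (RingHom.fst (∀ k, A k) (∀ k, B k)))) g = 1) →
      (∀ k', Matrix.GeneralLinearGroup.map (((Pi.evalRingHom B k').comp (RingHom.snd (∀ k, A k) (∀ k, B k)))) g = 1) →
      f g = 1) :
    f = 1 := by
  classical
  -- the matrix ring over the product is the product of the matrix rings
  let φ : Matrix ι ι ((∀ k, A k) × (∀ k, B k)) ≃+* (∀ k, Matrix ι ι (A k)) × (∀ k, Matrix ι ι (B k)) :=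
    { toFun := fun M => (fun k => M.map (((Pi.evalRingHom A k).comp (RingHom.fst (∀ k, A k) (∀ k, B k)))), fun k => M.map (((Pi.evalRingHom B k).comp (RingHom.snd (∀ k, A k) (∀ k, B k)))))
      invFun := fun P => Matrix.of fun i j => (fun k => P.1 k i j, fun k => P.2 k i j)
      left_inv := fun M => by ext i j <;> rfl
      right_inv := fun P => by ext k i j <;> rfl
      map_mul' := fun M N => by
        refine Prod.ext (funext fun k => ?_) (funext fun k => ?_)
        · change (M * N).map (((Pi.evalRingHom A k).comp (RingHom.fst (∀ k, A k) (∀ k, B k)))) = M.map (((Pi.evalRingHom A k).comp (RingHom.fst (∀ k, A k) (∀ k, B k)))) * N.map (((Pi.evalRingHom A k).comp (RingHom.fst (∀ k, A k) (∀ k, B k))))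
          rw [Matrix.map_mul]
        · change (M * N).map (((Pi.evalRingHom B k).comp (RingHom.snd (∀ k, A k) (∀ k, B k)))) = M.map (((Pi.evalRingHom B k).comp (RingHom.snd (∀ k, A k) (∀ k, B k)))) * N.map (((Pi.evalRingHom B k).comp (RingHom.snd (∀ k, A k) (∀ k, B k))))
          rw [Matrix.map_mul]
      map_add' := fun M N => by
        refine Prod.ext (funext fun k => ?_) (funext fun k => ?_) <;> rfl }
  let Φ : GL ι ((∀ k, A k) × (∀ k, B k)) ≃* (∀ k, GL ι (A k)) × (∀ k, GL ι (B k)) :=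
    (Units.mapEquiv φ.toMulEquiv).trans (MulEquiv.prodUnits.trans (MulEquiv.prodCongr MulEquiv.piUnits MulEquiv.piUnits))
  have hΦ1 : ∀ (x : GL ι ((∀ k, A k) × (∀ k, B k))) k, (Φ x).1 k = Matrix.GeneralLinearGroup.map (((Pi.evalRingHom A k).comp (RingHom.fst (∀ k, A k) (∀ k, B k)))) x :=
    fun x k => Units.ext rfl
  have hΦ2 : ∀ (x : GL ι ((∀ k, A k) × (∀ k, B k))) k, (Φ x).2 k = Matrix.GeneralLinearGroup.map (((Pi.evalRingHom B k).comp (RingHom.snd (∀ k, A k) (∀ k, B k)))) x :=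
    fun x k => Units.ext rfl
  -- `f` kills products of squares
  have hkill : ∀ x ∈ Subgroup.closure {g : GL ι ((∀ k, A k) × (∀ k, B k)) | IsSquare g}, f x = 1 := by
    intro x hx
    have hle : Subgroup.closure {g : GL ι ((∀ k, A k) × (∀ k, B k)) | IsSquare g} ≤ f.ker :=
      (Subgroup.closure_le _).2 fun y ⟨r, hr⟩ => by rw [SetLike.mem_coe, MonoidHom.mem_ker, hr]; exact hsq r
    exact (MonoidHom.mem_ker).1 (hle hx)
  -- the pulled-back homomorphism on the product, restricted to the two factors
  set F' : ((∀ k, GL ι (A k)) × (∀ k, GL ι (B k))) →* M := f.comp Φ.symm.toMonoidHom with hF'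
  have hA1 : F'.comp (MonoidHom.inl (∀ k, GL ι (A k)) (∀ k, GL ι (B k))) = 1 := by
    refine MonoidHom.pi_ext fun k x => ?_
    rw [MonoidHom.one_apply]
    -- `x = u` or `u · ε_k`
    have hsingle_sq : ∀ u ∈ Subgroup.closure {g : GL ι (A k) | IsSquare g},
        (F'.comp (MonoidHom.inl (∀ k, GL ι (A k)) (∀ k, GL ι (B k)))) (Pi.mulSingle k u) = 1 := by
      intro u hu
      have hmem := map_mem_closure_isSquare
        (Φ.symm.toMonoidHom.comp ((MonoidHom.inl (∀ k, GL ι (A k)) (∀ k, GL ι (B k))).comp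
          (MonoidHom.mulSingle (fun k => GL ι (A k)) k))) hu
      exact hkill _ hmem
    have hsingle_ε : (F'.comp (MonoidHom.inl (∀ k, GL ι (A k)) (∀ k, GL ι (B k)))) (Pi.mulSingle k (ε k)) = 1 := by
      change f (Φ.symm (Pi.mulSingle k (ε k), 1)) = 1
      refine hε k _ ?_ (fun k' hk' => ?_) (fun k' => ?_)
      · rw [← hΦ1, Φ.apply_symm_apply]
        exact Pi.mulSingle_eq_same (M := fun k => GL ι (A k)) k (ε k)
      · rw [← hΦ1, Φ.apply_symm_apply]
        exact Pi.mulSingle_eq_of_ne (M := fun k => GL ι (A k)) hk' (ε k)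
      · rw [← hΦ2, Φ.apply_symm_apply]
        rfl
    obtain ⟨u, hu, hx⟩ := hA k x
    rcases hx with rfl | rfl
    · exact hsingle_sq _ hu
    · have hmul : (Pi.mulSingle k (u * ε k) : ∀ k, GL ι (A k)) = Pi.mulSingle k u * Pi.mulSingle k (ε k) :=
        Pi.mulSingle_mul (f := fun k => GL ι (A k)) k u (ε k)
      rw [hmul, map_mul, hsingle_sq u hu, hsingle_ε, one_mul]
  have hB1 : F'.comp (MonoidHom.inr (∀ k, GL ι (A k)) (∀ k, GL ι (B k))) = 1 := by
    refine MonoidHom.pi_ext fun k x => ?_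
    rw [MonoidHom.one_apply]
    have hx : x ∈ Subgroup.closure {g : GL ι (B k) | IsSquare g} := (hB k) ▸ Subgroup.mem_top x
    have hmem := map_mem_closure_isSquare
      (Φ.symm.toMonoidHom.comp ((MonoidHom.inr (∀ k, GL ι (A k)) (∀ k, GL ι (B k))).comp
        (MonoidHom.mulSingle (fun k => GL ι (B k)) k))) hx
    exact hkill _ hmem
  -- assemble
  ext g
  rw [MonoidHom.one_apply]
  have hg : g = Φ.symm (((Φ g).1, 1) * (1, (Φ g).2)) := by
    rw [Prod.mk_mul_mk, mul_one, one_mul, Prod.mk.eta, Φ.symm_apply_apply]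
  have h1 : f (Φ.symm ((Φ g).1, 1)) = 1 := by
    have := DFunLike.congr_fun hA1 (Φ g).1
    rwa [MonoidHom.comp_apply, MonoidHom.inl_apply, MonoidHom.one_apply] at this
  have h2 : f (Φ.symm (1, (Φ g).2)) = 1 := by
    have := DFunLike.congr_fun hB1 (Φ g).2
    rwa [MonoidHom.comp_apply, MonoidHom.inr_apply, MonoidHom.one_apply] at this
  rw [hg, map_mul, map_mul, h1, h2, one_mul]

end Components

end Literature.LinearAlgebra.Matrix.GeneralLinearGroup
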